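import Literature.Topology.FourManifolds.PlumbedUnionHomology
import Literature.Topology.FourManifolds.SphereFamilySurgery
import Literature.AlgebraicTopology.Homotopy.StrongDeformationRetractSqueeze
import Mathlib.Analysis.Convex.Contractible
import HarnessLib

/-!
# The homology of the plumbed open neighbourhood of the middle-level configuration, in degrees `≥ 2`

Topic `Literature/Topology/FourManifolds` (fact seat
`provefact-Literature.Topology.FourManifolds.Matvey-69322e0896`, rung (H4)
`Literature.Topology.FourManifolds.Matveyev1996_partOne_and_fact_of_dualSpheres` of
`CorkDecompositionMiddleLevel.lean`).  Matveyev 1996 (arXiv:dg-ga/9505001), Proof of Theorem,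
step 1: *"Manifold `V₀` has a free fundamental group and its second homology are generated by
classes of spheres `Sᵢ` and `Pᵢ`"* (`V₀ = Nd_N(S_* ∪ P_*)`; Kirby 1996, arXiv:math/9712231,
§3).  The tree presents `V₀` through the function `g` of `PlumbedNeighbourhoodData.lean`, whose
sublevel sets are sandwiched between the open sets `U(t) = {H_S < t} ∪ {H_P < t}` — unions of
the round tubes of two framed families meeting in disjoint chart boxes.  This file proves the
homological sentence for `U(t)` in degrees `≥ 2`: **the inclusions of the core spheres induce
a bijection `Πᵢ Hₖ(Sᵢ) × Πⱼ Hₖ(Pⱼ) → Hₖ(U(t))` for every `k ≥ 2`** — so, for 2-spheres in a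
4-manifold and `k = 2`, `H₂(U(t))` is free on the classes of the spheres, and `Hₖ(U(t)) = 0` for
`k ≥ 3`.  Ingredients, all proved here or in the tree: a round tube strongly deformation
retracts onto its core sphere (fibrewise radial deformation), hence the core inclusion is an
isomorphism on homology (`StrongDeformationRetractSqueeze.lean`, homotopy invariance); a chart
box is contractible (convex), hence acyclic; and the Mayer–Vietoris computation of
`PlumbedUnionHomology.lean` (Hatcher 2002, §2.2 p. 149, Prop. 2.6).  Everything is proved; no
definitions, no named facts:

* `Literature.Topology.FourManifolds.FramedSphereFamily.isStrongDeformationRetractOf_sphere_tube`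
  — the round tube `φᵢ(Sᵏ × B(0, r))` of a framed family strongly deformation retracts onto the
  core sphere `φᵢ(Sᵏ × 0)`;
  `Literature.Topology.FourManifolds.FramedSphereFamily.isIso_map_sphere_subset_tube` — the
  inclusion of the core induces isomorphisms `Hₙ(Sᵢ) ≅ Hₙ(φᵢ(Sᵏ × B(0, r)))`;
* `Literature.Topology.FourManifolds.isZero_singularHomology_symm_image_of_convex` — the
  preimage under a chart of a convex subset of its target is acyclic in positive degrees;
* `Literature.Topology.FourManifolds.FramedSphereFamily.bijective_sum_map_cores_plumbedUnion`
  — **the homology of `U(t)` in degrees `≥ 2`**, from the structure data of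
  `FramedSphereFamily.exists_plumbingData`.

## References

* R. Matveyev, *A decomposition of smooth simply-connected h-cobordant 4-manifolds*,
  J. Differential Geom. 44 (1996) 571–582; arXiv:dg-ga/9505001, Proof of Theorem, step 1.
  [Matveyev1996]
* R. Kirby, *Akbulut's corks and h-cobordisms of smooth, simply connected 4-manifolds*, Turkish
  J. Math. 20 (1996) 85–93; arXiv:math/9712231, §3. [KirbyCorks1996]
* A. Hatcher, *Algebraic Topology*, CUP 2002, Ch. 0 p. 2 (deformation retractions), §2.1
  Cor. 2.11, §2.2 p. 149, Prop. 2.6. [HatcherAT2002]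
-/

noncomputable section

open CategoryTheory Limits Set Function Metric
open scoped Manifold ContDiff Topology unitInterval

universe u v

namespace Literature.Topology.FourManifolds

open Literature.AlgebraicTopology.SingularHomology Literature.AlgebraicTopology.Homotopy

variable (R : Type v) [CommRing R] (M : Type v) [AddCommGroup M] [Module R M]

/-! ### A round tube strongly deformation retracts onto its core sphere -/

namespace FramedSphereFamily

variable {EX HX : Type*} [NormedAddCommGroup EX] [NormedSpace ℝ EX] [TopologicalSpace HX]
  {IX : ModelWithCorners ℝ EX HX} {X : Type u} [TopologicalSpace X] [ChartedSpace HX X]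
  {ι : Type*} {k m : ℕ}

/-- **A round tube strongly deformation retracts onto its core sphere**: for a framed family
`ν` with tubes `φᵢ : Sᵏ × ℝᵐ ↪ X` and `r > 0`, the open tube `φᵢ(Sᵏ × B(0, r))` strongly
deformation retracts onto the core `φᵢ(Sᵏ × 0)` by the fibrewise radial deformation
`φᵢ(x, w) ↦ φᵢ(x, (1 - s) w)` (Hatcher 2002, Ch. 0, p. 2; the zero section of a disc bundle).
[cite: HatcherAT2002, Ch. 0 p. 2] -/
theorem isStrongDeformationRetractOf_sphere_tube (ν : FramedSphereFamily IX X ι k m) (i : ι)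
    (r : ℝ) :
    IsStrongDeformationRetractOf (range (ν.sphere i))
      (ν.toFun i '' (univ ×ˢ ball (0 : EuclideanSpace ℝ (Fin m)) r)) := by
  set T : Set X := ν.toFun i '' (univ ×ˢ ball (0 : EuclideanSpace ℝ (Fin m)) r) with hT
  have ho : Topology.IsOpenEmbedding (ν.toFun i) :=
    ⟨(ν.isSmoothEmbedding i).isEmbedding, ν.isOpen_range i⟩
  haveI : Nonempty ((Metric.sphere (0 : EuclideanSpace ℝ (Fin (k + 1))) 1) ×
      EuclideanSpace ℝ (Fin m)) := by
    haveI : Nonempty (Metric.sphere (0 : EuclideanSpace ℝ (Fin (k + 1))) 1) :=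
      ⟨⟨EuclideanSpace.single 0 1, by simp⟩⟩
    infer_instance
  set K := ho.toOpenPartialHomeomorph (ν.toFun i) with hK
  have hKapply : ∀ q, K q = ν.toFun i q := fun q => by
    rw [hK, Topology.IsOpenEmbedding.toOpenPartialHomeomorph_apply]
  have hKtgt : K.target = range (ν.toFun i) := by
    rw [hK, Topology.IsOpenEmbedding.toOpenPartialHomeomorph_target]
  have hleft : ∀ q, K.symm (ν.toFun i q) = q := fun q => by
    rw [hK]; exact ho.toOpenPartialHomeomorph_left_inv
  have hright : ∀ z ∈ range (ν.toFun i), ν.toFun i (K.symm z) = z := fun z hz => by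
    rw [hK]; exact Topology.IsOpenEmbedding.toOpenPartialHomeomorph_right_inv (ν.toFun i) ho hz
  have hTsub : T ⊆ range (ν.toFun i) := image_subset_range _ _
  have hTmem : ∀ z ∈ T, ‖(K.symm z).2‖ < r := by
    rintro _ ⟨q, hq, rfl⟩
    rw [hleft]
    simpa using hq.2
  -- the deformation
  have hcont : Continuous fun p : I × ↥T =>
      ν.toFun i ((K.symm (p.2 : X)).1, (1 - (p.1 : ℝ)) • (K.symm (p.2 : X)).2) := by
    have hsymm : Continuous fun z : ↥T => K.symm (z : X) := by
      have h := K.continuousOn_symm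
      rw [hKtgt] at h
      exact h.comp_continuous continuous_subtype_val fun z => hTsub z.2
    refine (ν.continuous i).comp ?_
    refine ((continuous_fst.comp hsymm).comp continuous_snd).prodMk ?_
    have hsI : Continuous fun p : I × ↥T => (p.1 : ℝ) :=
      continuous_subtype_val.comp continuous_fst
    exact (continuous_const.sub hsI).smul ((continuous_snd.comp hsymm).comp continuous_snd)
  have hmem : ∀ p : I × ↥T,
      ν.toFun i ((K.symm (p.2 : X)).1, (1 - (p.1 : ℝ)) • (K.symm (p.2 : X)).2) ∈ T := by
    rintro ⟨s, z⟩
    refine ⟨((K.symm (z : X)).1, (1 - (s : ℝ)) • (K.symm (z : X)).2), ⟨mem_univ _, ?_⟩, rfl⟩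
    rw [mem_ball, dist_zero_right, norm_smul, Real.norm_eq_abs]
    have h1 : |1 - (s : ℝ)| ≤ 1 := by
      rw [abs_le]
      constructor <;> linarith [s.2.1, s.2.2]
    calc |1 - (s : ℝ)| * ‖(K.symm (z : X)).2‖ ≤ 1 * ‖(K.symm (z : X)).2‖ := by
          gcongr
      _ = ‖(K.symm (z : X)).2‖ := one_mul _
      _ < r := hTmem z z.2
  refine ⟨⟨fun p => ⟨_, hmem p⟩, Continuous.subtype_mk hcont _⟩, fun z => ?_, fun z => ?_,
    fun s z hz => ?_⟩
  · -- at time `0`: the identity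
    apply Subtype.ext
    show ν.toFun i ((K.symm (z : X)).1, (1 - ((0 : I) : ℝ)) • (K.symm (z : X)).2) = z
    rw [show ((0 : I) : ℝ) = 0 from rfl, sub_zero, one_smul, Prod.mk.eta]
    exact hright _ (hTsub z.2)
  · -- at time `1`: on the core sphere
    show ν.toFun i ((K.symm (z : X)).1, (1 - ((1 : I) : ℝ)) • (K.symm (z : X)).2) ∈
      range (ν.sphere i)
    rw [show ((1 : I) : ℝ) = 1 from rfl, sub_self, zero_smul]
    exact ⟨_, rfl⟩
  · -- the core is fixed
    obtain ⟨x, hx⟩ := hz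
    apply Subtype.ext
    show ν.toFun i ((K.symm (z : X)).1, (1 - (s : ℝ)) • (K.symm (z : X)).2) = z
    rw [← hx, ν.sphere_apply, hleft]
    simp only [smul_zero]

/-- **The inclusion of the core sphere into a round tube is an isomorphism on homology**
(homotopy invariance along the strong deformation retraction
`isStrongDeformationRetractOf_sphere_tube`; Hatcher 2002, Cor. 2.11).
[cite: HatcherAT2002, §2.1 Cor. 2.11] -/
theorem isIso_map_sphere_subset_tube (ν : FramedSphereFamily IX X ι k m) (i : ι) {r : ℝ}
    (h : range (ν.sphere i) ⊆ ν.toFun i '' (univ ×ˢ ball (0 : EuclideanSpace ℝ (Fin m)) r))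
    (n : ℕ) : IsIso (singularHomology.map R M (subsetInclusion h) n) := by
  obtain ⟨e, he⟩ := (ν.isStrongDeformationRetractOf_sphere_tube i
      r).exists_homotopyEquiv_inclusion h
  have hiso := (singularHomology.isoOfHomotopyEquiv R M e n).isIso_hom
  rw [singularHomology.isoOfHomotopyEquiv] at hiso
  dsimp only at hiso
  rwa [he] at hiso

/-- The core sphere lies in every round tube of positive radius. [folklore] -/
theorem range_sphere_subset_tube (ν : FramedSphereFamily IX X ι k m) (i : ι) {r : ℝ}
    (hr : 0 < r) :
    range (ν.sphere i) ⊆ ν.toFun i '' (univ ×ˢ ball (0 : EuclideanSpace ℝ (Fin m)) r) := by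
  rintro _ ⟨x, rfl⟩
  exact ⟨(x, 0), ⟨mem_univ _, mem_ball_self hr⟩, rfl⟩

/-- A round tube of a framed family is open. [folklore] -/
theorem isOpen_tube (ν : FramedSphereFamily IX X ι k m) (i : ι) (r : ℝ) :
    IsOpen (ν.toFun i '' (univ ×ˢ ball (0 : EuclideanSpace ℝ (Fin m)) r)) := by
  have ho : Topology.IsOpenEmbedding (ν.toFun i) :=
    ⟨(ν.isSmoothEmbedding i).isEmbedding, ν.isOpen_range i⟩
  exact ho.isOpenMap _ (isOpen_univ.prod isOpen_ball)

/-- The round tubes of a framed family are pairwise disjoint. [folklore] -/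
theorem pairwise_disjoint_tube (ν : FramedSphereFamily IX X ι k m) (r : ℝ) :
    Pairwise (Disjoint on fun i => ν.toFun i '' (univ ×ˢ ball (0 : EuclideanSpace ℝ (Fin m)) r)) :=
  fun _ _ hij => Set.disjoint_of_subset (image_subset_range _ _) (image_subset_range _ _)
    (ν.disjoint_range hij)

end FramedSphereFamily

/-! ### Chart boxes are acyclic -/

section Box

variable {X : Type u} [TopologicalSpace X] {E : Type*} [NormedAddCommGroup E] [NormedSpace ℝ E]

/-- **The preimage under a chart of a convex subset of its target is acyclic in positive
degrees**: it is homeomorphic to the convex set, which is contractible (Hatcher 2002, §2.1,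
Prop. 2.8 with Cor. 2.11). [cite: HatcherAT2002, §2.1 Cor. 2.11] -/
theorem isZero_singularHomology_symm_image_of_convex (Φ : OpenPartialHomeomorph X E) {s : Set E}
    (hs : Convex ℝ s) (hne : s.Nonempty) (hst : s ⊆ Φ.target) {n : ℕ} (hn : n ≠ 0) :
    IsZero (singularHomology R M ↥(Φ.symm '' s) n) := by
  haveI : ContractibleSpace ↥s := hs.contractibleSpace hne
  have e : ↥s ≃ₜ ↥(Φ.symm '' s) :=
    Φ.symm.homeomorphOfImageSubsetSource (by rw [Φ.symm_source]; exact hst) rfl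
  haveI : ContractibleSpace ↥(Φ.symm '' s) := e.symm.contractibleSpace_iff.mpr inferInstance
  exact isZero_singularHomology_of_contractibleSpace R M hn

end Box

/-! ### The homology of the plumbed open neighbourhood in degrees `≥ 2` -/

namespace FramedSphereFamily

variable {n a b : ℕ} {N : Type u} [TopologicalSpace N]
  [ChartedSpace (EuclideanSpace ℝ (Fin (n + 1))) N]
  {ι ι' : Type*} [Fintype ι] [Fintype ι']

/-- **The homology of the plumbed open neighbourhood of the middle-level configuration in
degrees `≥ 2`** (Matveyev 1996, step 1: *"its second homology are generated by classes of
spheres `Sᵢ` and `Pᵢ`"*; Hatcher 2002, §2.2 p. 149).  In the situation produced by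
`FramedSphereFamily.exists_plumbingData` — framed families `S`, `P` and `S'`, `P'` with the same
core spheres, functions `H_S`, `H_P` whose thin tubes `{H_S < t}`, `{H_P < t}` (`0 < t ≤ τ`)
are the unions of the round `√t`-tubes of `S'`, `P'` and meet in the pairwise disjoint chart
boxes `Φ_c⁻¹(B(0, √t) × B(0, √t))` at the finitely many crossings — for every `0 < t ≤ τ` and
every `q`, the inclusions of the core spheres into `U(t) = {H_S < t} ∪ {H_P < t}` induce a
bijection `(x, y) ↦ Σᵢ (Sᵢ ↪ U(t))_* xᵢ + Σⱼ (Pⱼ ↪ U(t))_* yⱼ :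
Πᵢ H_{q+2}(Sᵢ) × Πⱼ H_{q+2}(Pⱼ) → H_{q+2}(U(t))`.  Proof: `bijective_sum_map_plumbedUnion` for
the round tubes and the boxes (open, pairwise disjoint, the boxes convex in the charts hence
acyclic), precomposed with the isomorphisms `Hₖ(Sᵢ) ≅ Hₖ(tube)` of
`isIso_map_sphere_subset_tube`.
[cite: Matveyev1996, Proof of Theorem, step 1 (arXiv p. 1)] [cite: HatcherAT2002, §2.2 p. 149 and
Prop. 2.6] -/
theorem bijective_sum_map_cores_plumbedUnion
    (S : FramedSphereFamily (𝓡 (n + 1)) N ι a b) (P : FramedSphereFamily (𝓡 (n + 1)) N ι' b a)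
    (S' : FramedSphereFamily (𝓡 (n + 1)) N ι a b) (P' : FramedSphereFamily (𝓡 (n + 1)) N ι' b a)
    (hS'zero : ∀ i x, S'.toFun i (x, 0) = S.toFun i (x, 0))
    (hP'zero : ∀ j y, P'.toFun j (y, 0) = P.toFun j (y, 0))
    (HS HP : N → ℝ) {τ : ℝ} (hCfin : (S.cores ∩ P.cores).Finite)
    (Φ : ↥(S.cores ∩ P.cores) →
      OpenPartialHomeomorph N (EuclideanSpace ℝ (Fin a) × EuclideanSpace ℝ (Fin b)))
    (hHSset : ∀ t : ℝ, 0 < t → t ≤ τ → {z | HS z < t} =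
      ⋃ i, S'.toFun i '' (univ ×ˢ ball (0 : EuclideanSpace ℝ (Fin b)) (Real.sqrt t)))
    (hHPset : ∀ t : ℝ, 0 < t → t ≤ τ → {z | HP z < t} =
      ⋃ j, P'.toFun j '' (univ ×ˢ ball (0 : EuclideanSpace ℝ (Fin a)) (Real.sqrt t)))
    (hbox : ∀ c, ball (0 : EuclideanSpace ℝ (Fin a)) (Real.sqrt τ) ×ˢ
      ball (0 : EuclideanSpace ℝ (Fin b)) (Real.sqrt τ) ⊆ (Φ c).target)
    (hboxdisj : Pairwise (Disjoint on fun c => (Φ c).symm ''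
      (ball (0 : EuclideanSpace ℝ (Fin a)) (Real.sqrt τ) ×ˢ
        ball (0 : EuclideanSpace ℝ (Fin b)) (Real.sqrt τ))))
    (hinter : ∀ t : ℝ, 0 < t → t ≤ τ → {z | HS z < t} ∩ {z | HP z < t} =
      ⋃ c, (Φ c).symm '' (ball (0 : EuclideanSpace ℝ (Fin a)) (Real.sqrt t) ×ˢ
        ball (0 : EuclideanSpace ℝ (Fin b)) (Real.sqrt t)))
    {t : ℝ} (ht : 0 < t) (htτ : t ≤ τ)
    (hSU : ∀ i, range (S.sphere i) ⊆ {z | HS z < t} ∪ {z | HP z < t})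
    (hPU : ∀ j, range (P.sphere j) ⊆ {z | HS z < t} ∪ {z | HP z < t}) (q : ℕ) :
    Function.Bijective fun p :
        ((i : ι) → singularHomology R M ↥(range (S.sphere i)) (q + 2)) ×
        ((j : ι') → singularHomology R M ↥(range (P.sphere j)) (q + 2)) =>
      (∑ i, singularHomology.map R M (subsetInclusion (hSU i)) (q + 2) (p.1 i)) +
        ∑ j, singularHomology.map R M (subsetInclusion (hPU j)) (q + 2) (p.2 j) := by
  classical
  haveI : Fintype ↥(S.cores ∩ P.cores) := hCfin.fintype
  have hst : 0 < Real.sqrt t := Real.sqrt_pos.2 ht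
  have hsqrt : Real.sqrt t ≤ Real.sqrt τ := Real.sqrt_le_sqrt htτ
  -- the pieces
  set A : ι → Set N := fun i => S'.toFun i '' (univ ×ˢ ball (0 : EuclideanSpace ℝ (Fin b))
    (Real.sqrt t)) with hA
  set B : ι' → Set N := fun j => P'.toFun j '' (univ ×ˢ ball (0 : EuclideanSpace ℝ (Fin a))
    (Real.sqrt t)) with hB
  set Q : ↥(S.cores ∩ P.cores) → Set N := fun c => (Φ c).symm ''
    (ball (0 : EuclideanSpace ℝ (Fin a)) (Real.sqrt t) ×ˢ
      ball (0 : EuclideanSpace ℝ (Fin b)) (Real.sqrt t)) with hQ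
  set U : Set N := {z | HS z < t} ∪ {z | HP z < t} with hU
  have hAeq : {z | HS z < t} = ⋃ i, A i := hHSset t ht htτ
  have hBeq : {z | HP z < t} = ⋃ j, B j := hHPset t ht htτ
  have hboxt : ball (0 : EuclideanSpace ℝ (Fin a)) (Real.sqrt t) ×ˢ
      ball (0 : EuclideanSpace ℝ (Fin b)) (Real.sqrt t) ⊆
      ball (0 : EuclideanSpace ℝ (Fin a)) (Real.sqrt τ) ×ˢ
        ball (0 : EuclideanSpace ℝ (Fin b)) (Real.sqrt τ) :=
    prod_mono (ball_subset_ball hsqrt) (ball_subset_ball hsqrt)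
  -- the hypotheses of `bijective_sum_map_plumbedUnion`
  have hAo : ∀ i, IsOpen (A i) := fun i => S'.isOpen_tube i _
  have hBo : ∀ j, IsOpen (B j) := fun j => P'.isOpen_tube j _
  have hQo : ∀ c, IsOpen (Q c) := fun c =>
    (Φ c).isOpen_image_symm_of_subset_target (isOpen_ball.prod isOpen_ball)
      (hboxt.trans (hbox c))
  have hAd : Pairwise (Disjoint on A) := S'.pairwise_disjoint_tube _
  have hBd : Pairwise (Disjoint on B) := P'.pairwise_disjoint_tube _
  have hQd : Pairwise (Disjoint on Q) := fun c c' hcc' =>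
    Set.disjoint_of_subset (image_mono hboxt) (image_mono hboxt) (hboxdisj hcc')
  have hAB : (⋃ i, A i) ∩ (⋃ j, B j) = ⋃ c, Q c := by
    rw [← hAeq, ← hBeq]
    exact hinter t ht htτ
  have hQz : ∀ c (k : ℕ), IsZero (singularHomology R M ↥(Q c) (k + 1)) := fun c k =>
    isZero_singularHomology_symm_image_of_convex R M (Φ c)
      ((convex_ball _ _).prod (convex_ball _ _)) ⟨(0, 0), mem_ball_self hst, mem_ball_self hst⟩
      (hboxt.trans (hbox c)) k.succ_ne_zero
  have hAC : ∀ i, A i ⊆ U := fun i z hz => Or.inl (by rw [hAeq]; exact mem_iUnion.2 ⟨i, hz⟩)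
  have hBC : ∀ j, B j ⊆ U := fun j z hz => Or.inr (by rw [hBeq]; exact mem_iUnion.2 ⟨j, hz⟩)
  have hC : U ⊆ (⋃ i, A i) ∪ (⋃ j, B j) := by rw [← hAeq, ← hBeq]
  have hbij := bijective_sum_map_plumbedUnion R M A B Q hAo hBo hQo hAd hBd hQd hAB hQz hAC hBC hC q
  -- the cores inside the tubes, isomorphically on homology
  have hSA : ∀ i, range (S.sphere i) ⊆ A i := fun i => by
    have h : range (S.sphere i) = range (S'.sphere i) := by
      ext z
      simp only [mem_range, FramedSphereFamily.sphere_apply, hS'zero]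
    rw [h]
    exact S'.range_sphere_subset_tube i hst
  have hPB : ∀ j, range (P.sphere j) ⊆ B j := fun j => by
    have h : range (P.sphere j) = range (P'.sphere j) := by
      ext z
      simp only [mem_range, FramedSphereFamily.sphere_apply, hP'zero]
    rw [h]
    exact P'.range_sphere_subset_tube j hst
  have hSiso : ∀ i, IsIso (singularHomology.map R M (subsetInclusion (hSA i)) (q + 2)) := by
    intro i
    have h : range (S.sphere i) = range (S'.sphere i) := by
      ext z
      simp only [mem_range, FramedSphereFamily.sphere_apply, hS'zero]
    have hSA' : range (S'.sphere i) ⊆ A i := S'.range_sphere_subset_tube i hst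
    have hiso := S'.isIso_map_sphere_subset_tube R M i hSA' (q + 2)
    have heq : (subsetInclusion (hSA i) : C(↥(range (S.sphere i)), ↥(A i))) =
        (subsetInclusion hSA').comp (⟨fun z => ⟨z.1, h ▸ z.2⟩, by fun_prop⟩) := by
      ext z
      rfl
    rw [heq, singularHomology.map_comp]
    haveI := hiso
    haveI : IsIso (singularHomology.map R M
        (⟨fun z : ↥(range (S.sphere i)) => (⟨z.1, h ▸ z.2⟩ : ↥(range (S'.sphere i))), by fun_prop⟩)
        (q + 2)) :=
      (singularHomology.mapIso R M (Homeomorph.setCongr h) (q + 2)).isIso_hom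
    infer_instance
  have hPiso : ∀ j, IsIso (singularHomology.map R M (subsetInclusion (hPB j)) (q + 2)) := by
    intro j
    have h : range (P.sphere j) = range (P'.sphere j) := by
      ext z
      simp only [mem_range, FramedSphereFamily.sphere_apply, hP'zero]
    have hPB' : range (P'.sphere j) ⊆ B j := P'.range_sphere_subset_tube j hst
    have hiso := P'.isIso_map_sphere_subset_tube R M j hPB' (q + 2)
    have heq : (subsetInclusion (hPB j) : C(↥(range (P.sphere j)), ↥(B j))) =
        (subsetInclusion hPB').comp (⟨fun z => ⟨z.1, h ▸ z.2⟩, by fun_prop⟩) := by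
      ext z
      rfl
    rw [heq, singularHomology.map_comp]
    haveI := hiso
    haveI : IsIso (singularHomology.map R M
        (⟨fun z : ↥(range (P.sphere j)) => (⟨z.1, h ▸ z.2⟩ : ↥(range (P'.sphere j))), by fun_prop⟩)
        (q + 2)) :=
      (singularHomology.mapIso R M (Homeomorph.setCongr h) (q + 2)).isIso_hom
    infer_instance
  -- composing
  have hfacS : ∀ i, (subsetInclusion (hSU i) : C(↥(range (S.sphere i)), ↥U)) =
      (subsetInclusion (hAC i)).comp (subsetInclusion (hSA i)) := fun i => by
    ext z
    rfl
  have hfacP : ∀ j, (subsetInclusion (hPU j) : C(↥(range (P.sphere j)), ↥U)) =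
      (subsetInclusion (hBC j)).comp (subsetInclusion (hPB j)) := fun j => by
    ext z
    rfl
  let eS : ∀ i, singularHomology R M ↥(range (S.sphere i)) (q + 2) ≅
      singularHomology R M ↥(A i) (q + 2) := fun i =>
    haveI := hSiso i
    asIso (singularHomology.map R M (subsetInclusion (hSA i)) (q + 2))
  let eP : ∀ j, singularHomology R M ↥(range (P.sphere j)) (q + 2) ≅
      singularHomology R M ↥(B j) (q + 2) := fun j =>
    haveI := hPiso j
    asIso (singularHomology.map R M (subsetInclusion (hPB j)) (q + 2))
  let T : (((i : ι) → singularHomology R M ↥(range (S.sphere i)) (q + 2)) ×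
      ((j : ι') → singularHomology R M ↥(range (P.sphere j)) (q + 2))) ≃
      (((i : ι) → singularHomology R M ↥(A i) (q + 2)) ×
        ((j : ι') → singularHomology R M ↥(B j) (q + 2))) :=
    Equiv.prodCongr (Equiv.piCongrRight fun i => (eS i).toLinearEquiv.toEquiv)
      (Equiv.piCongrRight fun j => (eP j).toLinearEquiv.toEquiv)
  have key : (fun p : ((i : ι) → singularHomology R M ↥(range (S.sphere i)) (q + 2)) ×
        ((j : ι') → singularHomology R M ↥(range (P.sphere j)) (q + 2)) =>
      (∑ i, singularHomology.map R M (subsetInclusion (hSU i)) (q + 2) (p.1 i)) +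
        ∑ j, singularHomology.map R M (subsetInclusion (hPU j)) (q + 2) (p.2 j)) =
      (fun p : ((i : ι) → singularHomology R M ↥(A i) (q + 2)) ×
          ((j : ι') → singularHomology R M ↥(B j) (q + 2)) =>
        (∑ i, singularHomology.map R M (subsetInclusion (hAC i)) (q + 2) (p.1 i)) +
          ∑ j, singularHomology.map R M (subsetInclusion (hBC j)) (q + 2) (p.2 j)) ∘ T := by
    funext p
    simp only [Function.comp_apply, hfacS, hfacP, singularHomology.map_comp, ModuleCat.comp_apply]
    rfl
  rw [key]
  exact hbij.comp (Equiv.bijective T)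

end FramedSphereFamily

end Literature.Topology.FourManifolds

end
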